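import Literature.NumberTheory.EllipticCurves.ModularCurve
import Literature.NumberTheory.EllipticCurves.QuadraticTwist
import Literature.NumberTheory.EllipticCurves.Isogeny
import Literature.NumberTheory.EllipticCurves.GlobalMinimalModel
import Literature.NumberTheory.DiophantineGeometry.Conductor
import HarnessLib
import HarnessLib.Audit.Tags

/-!
# Candidate E-an-10 (THEOREM I target): the `−1`-orbit Manin equality at `2⁵ ∣ N` (`MinusOneOrbitManinEq`)
# — cell `bsd-f2-manin` (D-0131 (3) frontier: the Manin constant at additive primes). `@[conjecture]`
# leaf (NOTHING asserted; definition only). Statement of record superseding the g1 row E-an-8 (ii)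
# (`MinusOneTwistRigidity`, landed) — same content with the proof route now complete on paper.

HONEST FRAMING. LENS = analytic / period-lattice (planner `bsd-f2-manin-an` g2, HOME
`run/shared/lean/pub/bsd-f2-manin/MEMO-an.md` PART III §§18–26, referee-grade proof HOME/an/PROOF-an.md), Prop
VERBATIM from HOME/an/Sketch-an3.lean (sha16 845c9227ccb9d3b8; audited copy HOME/ref1-C13-an-g2.lean) with
`IsLatticeOptimal D` inlined as the lattice clause `Λ_W = c·Λ_f`. PROOF ROUTE (memo §20): S-an-9 (Lemma T at 2:
`16 ∣ N ⇒ i·Λ_{f⊗χ₋₄} ⊆ Λ_f`, from `f|τ₄ = i·(f ⊗ χ₋₄)`, `τ₄ ∈ Norm Γ₀(N)`; print-implicit, Atkin–Lehner 1970)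
both ways gives `Λ_{f⊗χ₋₄} = i Λ_f` exactly; S-an-10 (Lemma loc: for `2⁵ ∣ N` the `−1`-twist is twist-minimal,
`Δ′ = Δ` — IN PRINT, Connell 1.1 / Pal 2012 Prop. 2.4(2); NOT typed as a leaf) and THEOREM A (E-an-9, the landed
`TwistOrbitManinTransport`, kernel-checked at odd `q`) both ways give `c(D′) = ±c(D)`.

THIS ROW (E-an-10 = THM I): `2⁵ ∣ N`, `W′ ~ W ⊗ χ₋₄` at the same conductor, `D`, `D′` lattice-optimal ⇒ the twist
of the optimal curve IS the optimal curve and `c(D′) = ±c(D)`. BC5 WITNESS (memo §22, HOME/an/g2-utilde_-1.out):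
296 554 ordered pairs (`v₂(N) = 5, 6, 7, 8`: 51 648, 70 640, 87 056, 87 210), ALL commuting, `Δ′ = Δ` in all; at
`2⁴ ∥ N` the twist is never of conductor `N` (263 682 classes). Refuter verdicts: REF1 **E-an-10 SURVIVES; S-an-9,
S-an-10 supports SURVIVE** 2026-08-27T17:30Z (HOME/REFUTER-ref1.md §R9.3; 10/10 BC7 CLEAN); REF2 (LIT-PLACEMENT
v4, 17:03Z): NOT-IN-PRINT, FOLKLORE-PROVABLE ⇒ beyond-print THEOREM candidate (S-an-9 PRINT-IMPLICIT, S-an-10 IN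
PRINT [Pal12 2.4; BD09 2.1(i)]). The sibling rows E-an-13 `DegreeGrowsTowardLargerDiscriminant d q M` and E-an-14
`OrbitOptimalCurveRigidity d q M` are parameterised schemas whose admissible instances `(d, q, M)` the planner
should list before they are typed (REFUTER-ref1 §R9.4: «SURVIVE at the instances the rows claim and FALSE at
(d, q) = (−1, 2) as bare parametrised Props — instance discipline»).
-/

noncomputable section

open scoped MatrixGroups ModularForm

open CongruenceSubgroup WeierstrassCurve
  Literature.NumberTheory.EllipticCurves Literature.NumberTheory.EllipticCurves.ModularForms

namespace Summit.BirchSwinnertonDyer.Rank1Residual.ManinAdditive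

/-- **Candidate E-an-10 `MinusOneOrbitManinEq` (cell bsd-f2-manin; THEOREM I target, beyond print, nothing
asserted):** `2⁵ ∣ N = W.conductorNorm ℤ`, `W′ ~ W ⊗ χ₋₄` of the same conductor, `D`, `D′` lattice-optimal data
at the conductor levels: there is a variable change with `u • (W ⊗ χ₋₁) = W′` (the twist of the optimal curve is
the optimal curve) and `c(D′) = c(D)` or `c(D′) = −c(D)`.
[cite: Stevens1989, Lemma (5.4) p. 97 (the Gauss-sum lattice inclusion behind the transport; the orbit equality
with c′ = ±c at 32 ∣ N is NOT in print — cell bsd-f2-manin MEMO-an.md §20, E-an-10)] -/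
@[conjecture] def MinusOneOrbitManinEq : Prop :=
  ∀ (W W' : WeierstrassCurve ℚ) [W.IsElliptic] [W.IsGloballyMinimal] [W'.IsElliptic]
    [W'.IsGloballyMinimal] [NeZero (W.conductorNorm ℤ)] [NeZero (W'.conductorNorm ℤ)]
    (D : ModularParametrizationData W (W.conductorNorm ℤ))
    (D' : ModularParametrizationData W' (W'.conductorNorm ℤ)),
    (∀ z ∈ D.L.lattice, ∃ w ∈ periodLattice D.f, z = D.c * w) →
    (∀ z ∈ D'.L.lattice, ∃ w ∈ periodLattice D'.f, z = D'.c * w) →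
    2 ^ 5 ∣ W.conductorNorm ℤ → W'.conductorNorm ℤ = W.conductorNorm ℤ →
    IsIsogenous (W.quadraticTwist ((-1 : ℤ) : ℚ)) W' →
    (∃ u : VariableChange ℚ, u • W.quadraticTwist ((-1 : ℤ) : ℚ) = W') ∧ (D'.c = D.c ∨ D'.c = -D.c)

end Summit.BirchSwinnertonDyer.Rank1Residual.ManinAdditive

end
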